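import Literature.Topology.FourManifolds.RegularLevelSplitting
import HarnessLib

/-!
# Functoriality of regular sublevel sets: maps induced by equivariant ambient maps

Topic `Literature/Topology/FourManifolds` (companion of `RegularLevelSplitting.lean`; fact seat
`provefact-Literature.SPC4.exists_isIntegralSurgeryLink`, the Lickorish–Wallace theorem: the symmetries
of the standard handlebodies — e.g. the reflection `z ↦ -z` of the solid torus
`{f ≤ 10000} ⊂ ℝ³` of `SolidTorusHandlebody.lean`, "every handlebody admits an
orientation-reversing symmetry", Juhász (2023), p. 97, the leaf F2b₂ of `LickorishWallace.lean` —
are induced by ambient diffeomorphisms preserving the defining function).  Everything here is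
**proved**.

For manifolds without boundary `M`, `N` modelled on `𝓡 (k + 1)`, smooth functions `f₁`, `f₂`
with a common regular level `a` (`h₁ : IsRegularLevel (𝓡 (k + 1)) f₁ a`, `h₂`), and a smooth map
`e : M → N` with `f₂ ∘ e = f₁`:

* `RegularSublevel.map h₁ h₂ e he : {f₁ ≤ a} → {f₂ ≤ a}` is smooth for the
  manifold-with-boundary structures (`contMDiff_map`; in the half-slice charts it is
  `Θ₂ ∘ e ∘ Θ₁⁻¹` restricted to the half-space) and preserves the boundary
  (`map_mem_boundary_iff`); its restriction to the boundaries
  `RegularSublevel.boundaryRestrict` is smooth for the boundary `k`-manifolds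
  (`contMDiff_boundaryRestrict`; in the boundary charts, `u ↦ tail (Θ₂ (e (Θ₁⁻¹ (0, u))))`);
* for a diffeomorphism `e`, the diffeomorphisms `RegularSublevel.mapDiffeomorph : Mᵃ ≅ Nᵃ` and
  `RegularSublevel.boundaryRestrictDiffeomorph : ∂Mᵃ ≅ ∂Nᵃ`, with
  `mapDiffeomorph ∘ incl = incl ∘ boundaryRestrictDiffeomorph` (`mapDiffeomorph_comp_incl`,
  definitional) — the shape of the data `(R, r)` in
  `Literature.Topology.FourManifolds.IsHandlebody.exists_diffeomorph_isOrientationReversing_boundary`.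

## References

* J. Milnor, *Morse theory*, Ann. of Math. Studies 51 (1963), §3, Thm. 3.1 (`Mᵃ`). [Milnor1963]
* A. Juhász, *Differential and Low-Dimensional Topology* (2023), §3.5, p. 97. [Juhasz2023]
-/

open scoped Manifold ContDiff Topology
open Set Function Filter

noncomputable section

universe u

namespace Literature.Topology.FourManifolds

/-- Local notation: `𝔼 n` is the model Euclidean space `EuclideanSpace ℝ (Fin n)`. -/
local notation "𝔼 " n:arg => EuclideanSpace ℝ (Fin n)

namespace RegularSublevel

variable {k : ℕ} {M : Type u} [TopologicalSpace M] [ChartedSpace (𝔼 (k + 1)) M]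
  [IsManifold (𝓡 (k + 1)) ∞ M] {N : Type u} [TopologicalSpace N] [ChartedSpace (𝔼 (k + 1)) N]
  [IsManifold (𝓡 (k + 1)) ∞ N] {f₁ : M → ℝ} {f₂ : N → ℝ} {a : ℝ}
  (h₁ : IsRegularLevel (𝓡 (k + 1)) f₁ a) (h₂ : IsRegularLevel (𝓡 (k + 1)) f₂ a)

/-- The map `M₁ᵃ → M₂ᵃ` induced by a smooth map `e : M → N` intertwining the functions,
`f₂ ∘ e = f₁`. [folklore] -/
def map (e : M → N) (he : ∀ x, f₂ (e x) = f₁ x) : RegularSublevel h₁ → RegularSublevel h₂ :=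
  fun p => mk h₂ (e (incl h₁ p)) (by rw [he]; exact apply_incl_le h₁ p)

omit [IsManifold (𝓡 (k + 1)) ∞ M] [IsManifold (𝓡 (k + 1)) ∞ N] in
/-- `map` on points of the ambient manifolds (definitional). [folklore] -/
@[simp]
theorem incl_map (e : M → N) (he : ∀ x, f₂ (e x) = f₁ x) (p : RegularSublevel h₁) :
    incl h₂ (map h₁ h₂ e he p) = e (incl h₁ p) := rfl

omit [IsManifold (𝓡 (k + 1)) ∞ M] [IsManifold (𝓡 (k + 1)) ∞ N] in
/-- `map` is continuous for a continuous `e`. [folklore] -/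
theorem continuous_map {e : M → N} (hec : Continuous e) (he : ∀ x, f₂ (e x) = f₁ x) :
    Continuous (map h₁ h₂ e he) :=
  Continuous.subtype_mk (hec.comp continuous_subtype_val) _

/-- **Functoriality of regular sublevel sets**: a smooth map `e : M → N` with `f₂ ∘ e = f₁`
induces a smooth map `{f₁ ≤ a} → {f₂ ≤ a}` of the manifolds with boundary (in the half-slice
charts `Θ₁` at `p` and `Θ₂` at `e p` it reads `Θ₂ ∘ e ∘ Θ₁⁻¹`, a smooth map of `ℝᵏ⁺¹`
restricted to the half-space). [folklore] -/
theorem contMDiff_map {e : M → N} (hes : ContMDiff (𝓡 (k + 1)) (𝓡 (k + 1)) ∞ e)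
    (he : ∀ x, f₂ (e x) = f₁ x) :
    ContMDiff (𝓡∂ (k + 1)) (𝓡∂ (k + 1)) ∞ (map h₁ h₂ e he) := by
  intro p
  set φ := map h₁ h₂ e he with hφ
  set D₁ := (halfSliceAtlas h₁).datum p with hD₁
  set D₂ := (halfSliceAtlas h₂).datum (φ p) with hD₂
  have hp1 : incl h₁ p ∈ D₁.Θ.source := (halfSliceAtlas h₁).mem_source p
  have hp2 : e (incl h₁ p) ∈ D₂.Θ.source := (halfSliceAtlas h₂).mem_source (φ p)
  -- the smooth local expression
  set G : 𝔼 (k + 1) → 𝔼 (k + 1) := D₂.Θ ∘ e ∘ D₁.Θ.symm with hG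
  set U : Set (𝔼 (k + 1)) := D₁.Θ.target ∩ D₁.Θ.symm ⁻¹' (e ⁻¹' D₂.Θ.source) with hU
  have hUopen : IsOpen U :=
    D₁.Θ.isOpen_inter_preimage_symm (D₂.Θ.open_source.preimage hes.continuous)
  have hGsmooth : ContDiffOn ℝ ∞ G U := by
    rw [← contMDiffOn_iff_contDiffOn]
    refine D₂.contMDiffOn_toFun.comp ((hes.comp_contMDiffOn (D₁.contMDiffOn_symm.mono
      inter_subset_left))) fun z hz => hz.2
  set z₀ : 𝔼 (k + 1) := D₁.Θ (incl h₁ p) with hz₀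
  have hz₀U : z₀ ∈ U := by
    refine ⟨D₁.Θ.map_source hp1, ?_⟩
    show e (D₁.Θ.symm (D₁.Θ (incl h₁ p))) ∈ D₂.Θ.source
    rw [D₁.Θ.left_inv hp1]; exact hp2
  have hself : extChartAt (𝓡∂ (k + 1)) p p = z₀ := (halfSliceAtlas h₁).extChartAt_self_apply p
  -- the written map agrees with `G` on the half-space part of `U`
  have heq : ∀ z ∈ U, 0 ≤ z 0 →
      (extChartAt (𝓡∂ (k + 1)) (φ p) ∘ φ ∘ (extChartAt (𝓡∂ (k + 1)) p).symm) z = G z := by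
    rintro z ⟨hz1, hz2⟩ hz0
    have hsymm : incl h₁ ((extChartAt (𝓡∂ (k + 1)) p).symm z) = D₁.Θ.symm z :=
      D₁.coe_extend_chart_symm_of_mem (p := p) hz0 hz1
    set q := (extChartAt (𝓡∂ (k + 1)) p).symm z with hq
    have hq2 : incl h₂ (φ q) ∈ D₂.Θ.source := by
      rw [incl_map, hsymm]; exact hz2
    show (extChartAt (𝓡∂ (k + 1)) (φ p)) (φ q) = G z
    have : (extChartAt (𝓡∂ (k + 1)) (φ p)) (φ q) = D₂.Θ (incl h₂ (φ q)) :=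
      D₂.extend_chart_apply (p := φ p) hq2
    rw [this, incl_map, hsymm]
    rfl
  rw [contMDiffAt_iff]
  refine ⟨(continuous_map h₁ h₂ hes.continuous he).continuousAt, ?_⟩
  have hGat : ContDiffWithinAt ℝ ∞ G (range (𝓡∂ (k + 1))) z₀ :=
    (hGsmooth.contDiffAt (hUopen.mem_nhds hz₀U)).contDiffWithinAt
  rw [hself]
  refine hGat.congr_of_eventuallyEq_of_mem ?_ (mem_range_modelHalf (D₁.apply_zero_nonneg hp1 p.2))
  have hmem : U ∈ 𝓝[range (𝓡∂ (k + 1))] z₀ := mem_nhdsWithin_of_mem_nhds (hUopen.mem_nhds hz₀U)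
  filter_upwards [hmem, self_mem_nhdsWithin] with z hz hzr
  rw [range_modelWithCornersEuclideanHalfSpace] at hzr
  exact heq z hz hzr

/-- **A diffeomorphism intertwining the functions induces a diffeomorphism of the regular
sublevel sets** `{f₁ ≤ a} ≅ {f₂ ≤ a}` (e.g. a symmetry `e` of `M` with `f ∘ e = f` induces a
self-diffeomorphism of `Mᵃ`). [folklore] -/
def mapDiffeomorph (e : M ≃ₘ⟮𝓡 (k + 1), 𝓡 (k + 1)⟯ N) (he : ∀ x, f₂ (e x) = f₁ x) :
    RegularSublevel h₁ ≃ₘ⟮𝓡∂ (k + 1), 𝓡∂ (k + 1)⟯ RegularSublevel h₂ :=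
  have he' : ∀ y, f₁ (e.symm y) = f₂ y := fun y => by rw [← he (e.symm y), e.apply_symm_apply]
  { toFun := map h₁ h₂ e he
    invFun := map h₂ h₁ e.symm he'
    left_inv := fun p => injective_incl h₁ (by simp)
    right_inv := fun q => injective_incl h₂ (by simp)
    contMDiff_toFun := contMDiff_map h₁ h₂ e.contMDiff he
    contMDiff_invFun := contMDiff_map h₂ h₁ e.symm.contMDiff he' }

/-- `mapDiffeomorph` on points of the ambient manifolds (definitional). [folklore] -/
@[simp]
theorem incl_mapDiffeomorph (e : M ≃ₘ⟮𝓡 (k + 1), 𝓡 (k + 1)⟯ N) (he : ∀ x, f₂ (e x) = f₁ x)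
    (p : RegularSublevel h₁) : incl h₂ (mapDiffeomorph h₁ h₂ e he p) = e (incl h₁ p) := rfl

/-- The induced map preserves the boundary (the level `f = a`). [folklore] -/
theorem map_mem_boundary_iff {e : M → N} (he : ∀ x, f₂ (e x) = f₁ x) (p : RegularSublevel h₁) :
    map h₁ h₂ e he p ∈ (𝓡∂ (k + 1)).boundary (RegularSublevel h₂) ↔
      p ∈ (𝓡∂ (k + 1)).boundary (RegularSublevel h₁) := by
  rw [mem_boundary_iff, mem_boundary_iff, incl_map, he]

/-- The restriction of the induced map to the boundaries. [folklore] -/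
def boundaryRestrict (e : M → N) (he : ∀ x, f₂ (e x) = f₁ x) :
    (𝓡∂ (k + 1)).boundary (RegularSublevel h₁) → (𝓡∂ (k + 1)).boundary (RegularSublevel h₂) :=
  fun z => ⟨map h₁ h₂ e he z.1, (map_mem_boundary_iff h₁ h₂ he z.1).2 z.2⟩

/-- The restriction to the boundaries intertwines the boundary inclusions (definitional).
[folklore] -/
@[simp]
theorem boundaryRestrict_coe (e : M → N) (he : ∀ x, f₂ (e x) = f₁ x)
    (z : (𝓡∂ (k + 1)).boundary (RegularSublevel h₁)) :
    ((boundaryRestrict h₁ h₂ e he z) : RegularSublevel h₂) = map h₁ h₂ e he z.1 := rfl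

/-- The restriction to the boundaries is continuous. [folklore] -/
theorem continuous_boundaryRestrict {e : M → N} (hec : Continuous e) (he : ∀ x, f₂ (e x) = f₁ x) :
    Continuous (boundaryRestrict h₁ h₂ e he) :=
  Continuous.subtype_mk ((continuous_map h₁ h₂ hec he).comp continuous_subtype_val) _

/-- **The restriction to the boundaries is smooth** (a map of the boundary `k`-manifolds): in
the boundary charts at `z` and at its image it reads `u ↦ tail (Θ₂ (e (Θ₁⁻¹ (0, u))))`.
[folklore] -/
theorem contMDiff_boundaryRestrict {e : M → N} (hes : ContMDiff (𝓡 (k + 1)) (𝓡 (k + 1)) ∞ e)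
    (he : ∀ x, f₂ (e x) = f₁ x) :
    ContMDiff (𝓡 k) (𝓡 k) ∞ (boundaryRestrict h₁ h₂ e he) := by
  intro z
  set ψ := boundaryRestrict h₁ h₂ e he with hψdef
  set D₁ := (halfSliceAtlas h₁).datum z.1 with hD₁
  set D₂ := (halfSliceAtlas h₂).datum (ψ z).1 with hD₂
  have hz1 : incl h₁ z.1 ∈ D₁.Θ.source := (halfSliceAtlas h₁).mem_source z.1
  have hz2 : e (incl h₁ z.1) ∈ D₂.Θ.source := (halfSliceAtlas h₂).mem_source (ψ z).1
  have hfz : f₁ (incl h₁ z.1) = a := apply_incl_boundary h₁ z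
  -- the smooth local expression and its domain
  set W' : 𝔼 k → 𝔼 k := fun u =>
    BoundaryManifold.tail k (D₂.Θ (e (D₁.Θ.symm (BoundaryManifold.consCLE k (u, 0))))) with hW'
  set U : Set (𝔼 k) := (fun u => BoundaryManifold.consCLE k (u, 0)) ⁻¹'
    (D₁.Θ.target ∩ D₁.Θ.symm ⁻¹' (e ⁻¹' D₂.Θ.source)) with hU
  have hUopen : IsOpen U :=
    (D₁.Θ.isOpen_inter_preimage_symm (D₂.Θ.open_source.preimage hes.continuous)).preimage
      (BoundaryManifold.contDiff_consCLE_zero k).continuous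
  have hW'smooth : ContDiffOn ℝ ∞ W' U := by
    have key : ContDiffOn ℝ ∞ (D₂.Θ ∘ e ∘ D₁.Θ.symm)
        (D₁.Θ.target ∩ D₁.Θ.symm ⁻¹' (e ⁻¹' D₂.Θ.source)) := by
      rw [← contMDiffOn_iff_contDiffOn]
      exact D₂.contMDiffOn_toFun.comp (hes.comp_contMDiffOn (D₁.contMDiffOn_symm.mono
        inter_subset_left)) fun v hv => hv.2
    exact (BoundaryManifold.contDiff_tail k).comp_contDiffOn
      (key.comp (BoundaryManifold.contDiff_consCLE_zero k).contDiffOn fun u hu => hu)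
  -- the base point in the chart
  set u₀ : 𝔼 k := extChartAt (𝓡 k) z z with hu₀
  have hΘz0 : D₁.Θ (incl h₁ z.1) 0 = 0 := datum_apply_zero_eq_zero h₁ z.1 hz1 hfz
  have hu₀eq : u₀ = BoundaryManifold.tail k (D₁.Θ (incl h₁ z.1)) := by
    show BoundaryManifold.tail k (chartAt (EuclideanHalfSpace (k + 1)) z.1 z.1).val = _
    rw [chartAt_eq]
    exact congrArg (BoundaryManifold.tail k) (D₁.modelHalf_chart_apply (p := z.1) hz1)
  have hcons : BoundaryManifold.consCLE k (u₀, 0) = D₁.Θ (incl h₁ z.1) := by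
    rw [hu₀eq]
    exact BoundaryManifold.consCLE_tail_of_eq_zero k hΘz0
  have hu₀U : u₀ ∈ U := by
    show BoundaryManifold.consCLE k (u₀, 0) ∈ D₁.Θ.target ∩ D₁.Θ.symm ⁻¹' (e ⁻¹' D₂.Θ.source)
    rw [hcons]
    refine ⟨D₁.Θ.map_source hz1, ?_⟩
    show e (D₁.Θ.symm (D₁.Θ (incl h₁ z.1))) ∈ D₂.Θ.source
    rw [D₁.Θ.left_inv hz1]
    exact hz2
  -- the written map agrees with `W'` on `U`
  have heq : ∀ u ∈ U, (extChartAt (𝓡 k) (ψ z) ∘ ψ ∘ (extChartAt (𝓡 k) z).symm) u = W' u := by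
    rintro u ⟨hu1, hu2⟩
    have hut : BoundaryManifold.toHalfSpace k u ∈ (chartAt (EuclideanHalfSpace (k + 1)) z.1).target :=
      hu1
    have hsymm : incl h₁ ((extChartAt (𝓡 k) z).symm u).1 =
        D₁.Θ.symm (BoundaryManifold.consCLE k (u, 0)) := by
      show incl h₁ ((BoundaryManifold.boundaryChart z).symm u).1 = _
      rw [incl, BoundaryManifold.coe_boundaryChart_symm_of_mem z hut, chartAt_eq]
      exact D₁.coe_chart_symm_of_mem hut
    set q := (extChartAt (𝓡 k) z).symm u with hq
    have hq2 : incl h₂ (ψ q).1 ∈ D₂.Θ.source := by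
      rw [boundaryRestrict_coe, incl_map, hsymm]; exact hu2
    have hval : (chartAt (EuclideanHalfSpace (k + 1)) (ψ z).1 (ψ q).1).val =
        D₂.Θ (incl h₂ (ψ q).1) := by
      rw [chartAt_eq]
      exact D₂.modelHalf_chart_apply (p := (ψ z).1) hq2
    show BoundaryManifold.tail k (chartAt (EuclideanHalfSpace (k + 1)) (ψ z).1 (ψ q).1).val = W' u
    rw [hval, boundaryRestrict_coe, incl_map, hsymm]
  -- conclusion
  rw [contMDiffAt_iff]
  refine ⟨(continuous_boundaryRestrict h₁ h₂ hes.continuous he).continuousAt, ?_⟩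
  have hW'at : ContDiffAt ℝ ∞ W' u₀ := hW'smooth.contDiffAt (hUopen.mem_nhds hu₀U)
  refine (hW'at.congr_of_eventuallyEq ?_).contDiffWithinAt
  filter_upwards [hUopen.mem_nhds hu₀U] with u hu
  exact heq u hu

/-- **A diffeomorphism intertwining the functions induces a diffeomorphism of the boundaries
of the regular sublevel sets**, compatible with the diffeomorphism `mapDiffeomorph` of the
sublevel sets themselves (`boundaryRestrict_coe`): e.g. a symmetry of `M` preserving `f` induces
a self-diffeomorphism `R` of `Mᵃ` and a self-diffeomorphism `r` of `∂Mᵃ` with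
`R ∘ incl = incl ∘ r`. [folklore] -/
def boundaryRestrictDiffeomorph (e : M ≃ₘ⟮𝓡 (k + 1), 𝓡 (k + 1)⟯ N) (he : ∀ x, f₂ (e x) = f₁ x) :
    (𝓡∂ (k + 1)).boundary (RegularSublevel h₁) ≃ₘ⟮𝓡 k, 𝓡 k⟯
      (𝓡∂ (k + 1)).boundary (RegularSublevel h₂) :=
  have he' : ∀ y, f₁ (e.symm y) = f₂ y := fun y => by rw [← he (e.symm y), e.apply_symm_apply]
  { toFun := boundaryRestrict h₁ h₂ e he
    invFun := boundaryRestrict h₂ h₁ e.symm he'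
    left_inv := fun z => Subtype.ext (injective_incl h₁ (by simp))
    right_inv := fun z => Subtype.ext (injective_incl h₂ (by simp))
    contMDiff_toFun := contMDiff_boundaryRestrict h₁ h₂ e.contMDiff he
    contMDiff_invFun := contMDiff_boundaryRestrict h₂ h₁ e.symm.contMDiff he' }

/-- Compatibility of the two induced diffeomorphisms with the boundary inclusions
`(boundaryData hᵢ).incl = Subtype.val`: `R ∘ incl = incl ∘ r`. [folklore] -/
theorem mapDiffeomorph_comp_incl (e : M ≃ₘ⟮𝓡 (k + 1), 𝓡 (k + 1)⟯ N) (he : ∀ x, f₂ (e x) = f₁ x)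
    (z : (𝓡∂ (k + 1)).boundary (RegularSublevel h₁)) :
    mapDiffeomorph h₁ h₂ e he ((boundaryData h₁).incl z) =
      (boundaryData h₂).incl (boundaryRestrictDiffeomorph h₁ h₂ e he z) := rfl

end RegularSublevel

end Literature.Topology.FourManifolds
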